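import Literature.Analysis.Complex.PickFunctions
import Literature.Analysis.Complex.PickFunctionsProofsCayley
import Literature.Analysis.Complex.HolomorphicParametricIntegral
import HarnessLib

/-!
# Loewner's theorem, Part II (matrix form): Pick continuation ⇒ matrix monotone

This file proves, sorry-free, the (←) direction of the named fact
`Literature.Analysis.Complex.loewner_theorem` (Löwner 1934; Rosenblum–Rovnyak 1985, Ch. 2,
Examples and Addenda no. 1, Part II restricted to `dim ℋ < ∞`):

* `isMatrixMonotoneOn_of_pick_continuation` : if `f = g|Δ` with `g` holomorphic on
  `Π ∪ Π̃ ∪ Δ` (`Δ` an open interval) and `Im g ≥ 0` on `Π`, then `f` is a monotone matrix function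
  of every order on `Δ` (`IsMatrixMonotoneOn f Δ`);
* `loewner_theorem_mpr` : the (←) implication of `loewner_theorem`, verbatim.

## The argument (an independent route avoiding Nevanlinna's integral representation)

Rosenblum–Rovnyak (Ch. 2 Addenda no. 2) prove Part II from (i) `B ≥ A ≥ δI ⇒ B⁻¹ ≤ A⁻¹`,
(ii) the resolvent atoms `x ↦ 1/(t - x)`, `t ∉ Δ`, are operator monotone on `Δ`, and (iii) the
Nevanlinna representation of `g` together with the Stieltjes inversion formula (the representing
measure vanishes on `Δ`), which exhibits `f` on `Δ` as a positive superposition of atoms.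
Steps (i)–(ii) are formalised here as printed (`inv_le_inv_of_posDef`, `atom_mono`, phrased for
the Möbius atoms `x ↦ (x-m)/(ρ - c(x-m))`, `|c| ≤ 1`, on `Δ = (m-ρ, m+ρ)`).  For step (iii) we
replace the (unproved in this tree) Nevanlinna representation by a finite-radius substitute that
only needs Cauchy's integral formula on circles (Mathlib):

1. *Reflection.* `g(z̄) = conj g(z)` on the slit domain (identity theorem on the star-shaped open
   set `{Im z ≠ 0 ∨ Re z ∈ Δ}`), hence `Im g ≤ 0` on `Π̃` (`apply_conj_eq_conj_of_real_on`).
2. *Uniformisation.* `J(ζ) = 2ζ/(1+ζ²)` maps the unit disc into `ℂ ∖ (ℝ ∖ (-1,1))`, the upper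
   half-disc into `Π`, the lower into `Π̃`, and `(-1,1)` onto itself with inverse
   `u(X) = X/(1+√(1-X²))` (`jouk_mem_pickDomain`, `jouk_u`).
3. *Semicircle formula.* For `G` holomorphic on the closed unit disc and real `|u| < 1`,
   `Re G(u) = Re G(0) + (2π)⁻¹∫₀^{2π} (2u Im ζ/|ζ-u|²) Im G(ζ) dθ` (`re_eq_re_zero_add_integral`;
   Cauchy formula + mean value property + Cauchy's theorem for `ζ ↦ uζ/(1-uζ) G(ζ)`).
4. *Kernel = atom.* With `u = u(X)`: `2u/|ζ-u|² = X/(1 - Re ζ · X)` (`kernel_eq_atom`), so for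
   `0 < r < 1` the function `F_r(x) = Re g(m + ρ J(r u((x-m)/ρ)))` is `Re g(m)` plus a positive
   continuous superposition of Möbius atoms, hence matrix monotone (`cfc_le_cfc_of_repr`, an
   integral of nonnegative quadratic forms), and `F_r → Re g = f` pointwise on `Δ` as `r → 1`;
   matrix monotonicity passes to the limit (`cfc_le_cfc_of_tendsto`).

Finite spectra are first enclosed in a bounded subinterval `(m-ρ, m+ρ) ⊆ Δ`.

## References

* [RosenblumRovnyak1985] M. Rosenblum, J. Rovnyak, *Hardy Classes and Operator Theory* (1985),
  Ch. 2, Examples and Addenda nos. 1–2 (statement and proof of Part II), §2.12.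
* [Loewner1934] K. Löwner, *Über monotone Matrixfunktionen*, Math. Z. 38 (1934) 177–216.

## Part B of this file: Nevanlinna's representation — the converse, and the discharge

Appended (2026-08-15) below the Loewner Part II development: the third file of the proof of the
named fact `Literature.Analysis.Complex.nevanlinna_representation` (Rosenblum–Rovnyak 1985,
Appendix §6, Theorem B and its converse), after `PickFunctionsProofsDisc` (Herglotz–Riesz on the
disc) and `PickFunctionsProofsCayley` (existence half via the Cayley transform):

* `norm_nevanlinna_kernel_le` — `|1/(t - z) - t/(1 + t²)| ≤ (|1 + z²|/Im z + |z|)/(1 + t²)` on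
  `Π`, from `1/(t - z) - t/(1 + t²) = (1 + z²)/((t - z)(1 + t²)) + z/(1 + t²)`;
* `im_nevanlinna_kernel_nonneg` — `Im (1/(t - z) - t/(1 + t²)) = Im z/|t - z|² ≥ 0`;
* `differentiableOn_nevanlinna_integral` — `z ↦ ∫ (1/(t - z) - t/(1 + t²)) dμ(t)` is
  holomorphic on `Π` when `∫ dμ/(1 + t²) < ∞` (dominated holomorphic parameter integral,
  `Literature.Analysis.Complex.differentiableOn_integral_of_dominated`, local majorant
  `C(z₀)/(1 + t²)` on `ball z₀ (Im z₀/2)`);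
* `isPickFunction_of_nevanlinna_repr` — the converse half of Theorem B;
* `nevanlinna_representation_holds` — the discharge.
-/

noncomputable section

open scoped ComplexOrder ComplexConjugate MatrixOrder Matrix.Norms.L2Operator
open Complex Set Filter Topology Metric Real Matrix

namespace Literature.Analysis.Complex

/-! ### Matrix side: resolvent monotonicity, quadratic forms, cones and limits -/

section MatrixSide

variable {n : ℕ}

/-- Löwner-order antitonicity of the inverse on positive definite matrices: `0 < C ≤ D` implies
`D⁻¹ ≤ C⁻¹` (Rosenblum–Rovnyak, Ch. 2 Addenda no. 2 (i)); obtained from Mathlib's C⋆-algebra lemma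
`CStarAlgebra.ringInverse_le_ringInverse` for the (scoped) L²-operator-norm C⋆-structure on
matrices. [cite: RosenblumRovnyak1985, Ch. 2 Examples and Addenda no. 2 (i)] -/
theorem inv_le_inv_of_posDef {C D : Matrix (Fin n) (Fin n) ℂ} (hC : C.PosDef) (hCD : C ≤ D) :
    D⁻¹ ≤ C⁻¹ := by
  letI : CStarAlgebra (Matrix (Fin n) (Fin n) ℂ) := {}
  rw [Matrix.nonsing_inv_eq_ringInverse, Matrix.nonsing_inv_eq_ringInverse]
  exact CStarAlgebra.ringInverse_le_ringInverse hCD (Matrix.isStrictlyPositive_iff_posDef.mpr hC)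

/-- The denominator `ρ - c(x-m)` of a Möbius atom is positive on `(m-ρ, m+ρ)` when `|c| ≤ 1`.
[folklore] -/
theorem atom_den_pos {m ρ c : ℝ} (hc : |c| ≤ 1) {x : ℝ} (hx : x ∈ Set.Ioo (m - ρ) (m + ρ)) :
    0 < ρ - c * (x - m) := by
  have h1 : |c * (x - m)| < ρ := by
    rw [abs_mul]
    have hxm : |x - m| < ρ := by
      rw [abs_lt]; constructor <;> linarith [hx.1, hx.2]
    calc |c| * |x - m| ≤ 1 * |x - m| := by gcongr
      _ = |x - m| := one_mul _
      _ < ρ := hxm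
  linarith [(abs_lt.mp h1).2]

/-- The Möbius atoms `x ↦ (x-m)/(ρ - c(x-m))`, `|c| ≤ 1`, are matrix monotone on `(m-ρ, m+ρ)`:
for `c = 0` the atom is affine increasing, for `c ≠ 0` it is `c⁻¹(ρ R(x) - 1)` with the resolvent
`R(x) = (ρ - c(x-m))⁻¹`, and resolvents are monotone by `inv_le_inv_of_posDef`
(Rosenblum–Rovnyak, Ch. 2 Addenda no. 2 (ii): `1/(t-x)`, `t ∉ Δ`, is a monotone operator function
on `Δ`). [cite: RosenblumRovnyak1985, Ch. 2 Examples and Addenda no. 2 (ii)] -/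
theorem atom_mono {m ρ c : ℝ} (hρ : 0 < ρ) (hc : |c| ≤ 1) {A B : Matrix (Fin n) (Fin n) ℂ}
    (hA : A.IsHermitian) (hB : B.IsHermitian)
    (hAs : spectrum ℝ A ⊆ Set.Ioo (m - ρ) (m + ρ)) (hBs : spectrum ℝ B ⊆ Set.Ioo (m - ρ) (m + ρ))
    (hAB : A ≤ B) :
    cfc (fun x : ℝ => (x - m) / (ρ - c * (x - m))) A ≤
      cfc (fun x : ℝ => (x - m) / (ρ - c * (x - m))) B := by
  have hA' : IsSelfAdjoint A := hA
  have hB' : IsSelfAdjoint B := hB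
  have hden : ∀ x ∈ Set.Ioo (m - ρ) (m + ρ), 0 < ρ - c * (x - m) := fun x hx => atom_den_pos hc hx
  rcases eq_or_ne c 0 with rfl | hc0
  · have hfun : (fun x : ℝ => (x - m) / (ρ - 0 * (x - m))) = fun x => ρ⁻¹ • x + (-(m / ρ)) := by
      ext x; simp only [zero_mul, sub_zero, smul_eq_mul]; field_simp; ring
    rw [hfun, cfc_add_const _ _ A, cfc_add_const _ _ B, cfc_smul_id _ A, cfc_smul_id _ B]
    rw [Matrix.le_iff] at hAB ⊢
    have : ρ⁻¹ • B + (algebraMap ℝ (Matrix (Fin n) (Fin n) ℂ)) (-(m / ρ)) -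
        (ρ⁻¹ • A + (algebraMap ℝ (Matrix (Fin n) (Fin n) ℂ)) (-(m / ρ))) = ρ⁻¹ • (B - A) := by
      rw [smul_sub]; abel
    rw [this]
    exact hAB.smul (inv_nonneg.mpr hρ.le)
  · have hfun : ∀ x ∈ Set.Ioo (m - ρ) (m + ρ),
        (x - m) / (ρ - c * (x - m)) = c⁻¹ * (ρ * (ρ - c * (x - m))⁻¹ - 1) := by
      intro x hx
      have := (hden x hx).ne'
      rw [div_eq_iff this]
      have hd : (ρ - c * (x - m))⁻¹ * (ρ - c * (x - m)) = 1 := inv_mul_cancel₀ this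
      calc x - m = c⁻¹ * (ρ * 1 - (ρ - c * (x - m))) := by field_simp; ring
        _ = c⁻¹ * (ρ * ((ρ - c * (x - m))⁻¹ * (ρ - c * (x - m))) - (ρ - c * (x - m))) := by rw [hd]
        _ = c⁻¹ * (ρ * (ρ - c * (x - m))⁻¹ - 1) * (ρ - c * (x - m)) := by ring
    rw [cfc_congr (fun x hx => hfun x (hAs hx)), cfc_congr (fun x hx => hfun x (hBs hx))]
    have key : ∀ (E : Matrix (Fin n) (Fin n) ℂ), IsSelfAdjoint E →
        spectrum ℝ E ⊆ Set.Ioo (m - ρ) (m + ρ) →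
        cfc (fun x : ℝ => c⁻¹ * (ρ * (ρ - c * (x - m))⁻¹ - 1)) E =
          c⁻¹ • (ρ • (algebraMap ℝ _ ρ - c • (E - algebraMap ℝ _ m))⁻¹ - 1) := by
      intro E hE hEs
      have hne : ∀ x ∈ spectrum ℝ E, ρ - c * (x - m) ≠ 0 := fun x hx => (hden x (hEs hx)).ne'
      have hcont : ∀ f : ℝ → ℝ, ContinuousOn f (spectrum ℝ E) := fun f =>
        (Matrix.finite_real_spectrum (A := E)).continuousOn f
      rw [cfc_const_mul _ _ E (hcont _), cfc_sub _ _ E (hcont _) (hcont _), cfc_const_one ℝ E,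
        cfc_const_mul _ _ E (hcont _), cfc_inv _ E hne (hcont _),
        ← Matrix.nonsing_inv_eq_ringInverse, cfc_sub _ _ E (hcont _) (hcont _),
        cfc_const ρ E, cfc_const_mul _ _ E (hcont _), cfc_sub _ _ E (hcont _) (hcont _),
        cfc_id' ℝ E, cfc_const m E]
    rw [key A hA' hAs, key B hB' hBs]
    set RA := (algebraMap ℝ (Matrix (Fin n) (Fin n) ℂ) ρ - c • (A - algebraMap ℝ _ m)) with hRA
    set RB := (algebraMap ℝ (Matrix (Fin n) (Fin n) ℂ) ρ - c • (B - algebraMap ℝ _ m)) with hRB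
    have hpos : ∀ (E : Matrix (Fin n) (Fin n) ℂ), IsSelfAdjoint E →
        spectrum ℝ E ⊆ Set.Ioo (m - ρ) (m + ρ) →
        (algebraMap ℝ (Matrix (Fin n) (Fin n) ℂ) ρ - c • (E - algebraMap ℝ _ m)).PosDef := by
      intro E hE hEs
      have hcont : ∀ f : ℝ → ℝ, ContinuousOn f (spectrum ℝ E) := fun f =>
        (Matrix.finite_real_spectrum (A := E)).continuousOn f
      have h1 : cfc (fun x : ℝ => ρ - c * (x - m)) E =
          algebraMap ℝ (Matrix (Fin n) (Fin n) ℂ) ρ - c • (E - algebraMap ℝ _ m) := by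
        rw [cfc_sub _ _ E (hcont _) (hcont _), cfc_const ρ E, cfc_const_mul _ _ E (hcont _),
          cfc_sub _ _ E (hcont _) (hcont _), cfc_id' ℝ E, cfc_const m E]
      rw [← h1, ← Matrix.isStrictlyPositive_iff_posDef]
      exact (cfc_isStrictlyPositive_iff _ E (hcont _) hE).mpr fun x hx => hden x (hEs hx)
    have hRApos : RA.PosDef := hpos A hA' hAs
    have hRBpos : RB.PosDef := hpos B hB' hBs
    rcases lt_or_gt_of_ne hc0 with hcneg | hcpos
    · have hRAB : RA ≤ RB := by
        rw [Matrix.le_iff] at hAB ⊢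
        have : RB - RA = (-c) • (B - A) := by
          simp only [hRA, hRB, smul_sub, neg_smul]; abel
        rw [this]; exact hAB.smul (by linarith)
      have hinv : RB⁻¹ ≤ RA⁻¹ := inv_le_inv_of_posDef hRApos hRAB
      rw [Matrix.le_iff] at hinv ⊢
      have : c⁻¹ • (ρ • RB⁻¹ - 1) - c⁻¹ • (ρ • RA⁻¹ - 1) = (-c⁻¹ * ρ) • (RA⁻¹ - RB⁻¹) := by
        rw [mul_smul, smul_sub ρ, neg_smul, ← smul_neg, neg_sub]
        simp only [smul_sub]; abel
      rw [this]
      exact hinv.smul (mul_nonneg (by simpa using (inv_lt_zero.mpr hcneg).le) hρ.le)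
    · have hRBA : RB ≤ RA := by
        rw [Matrix.le_iff] at hAB ⊢
        have : RA - RB = c • (B - A) := by
          simp only [hRA, hRB, smul_sub]; abel
        rw [this]; exact hAB.smul hcpos.le
      have hinv : RA⁻¹ ≤ RB⁻¹ := inv_le_inv_of_posDef hRBpos hRBA
      rw [Matrix.le_iff] at hinv ⊢
      have : c⁻¹ • (ρ • RB⁻¹ - 1) - c⁻¹ • (ρ • RA⁻¹ - 1) = (c⁻¹ * ρ) • (RB⁻¹ - RA⁻¹) := by
        rw [mul_smul, smul_sub ρ]
        simp only [smul_sub]; abel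
      rw [this]
      exact hinv.smul (mul_nonneg (inv_pos.mpr hcpos).le hρ.le)

/-- The quadratic form of `cfc F A` for a Hermitian matrix `A = U diag(λ) U⋆`:
`v⋆ F(A) v = ∑ᵢ F(λᵢ) |(U⋆ v)ᵢ|²`. [folklore] -/
theorem star_dotProduct_cfc_mulVec {A : Matrix (Fin n) (Fin n) ℂ} (hA : A.IsHermitian)
    (F : ℝ → ℝ) (v : Fin n → ℂ) :
    star v ⬝ᵥ (cfc F A *ᵥ v) =
      ((∑ i, F (hA.eigenvalues i) *
        Complex.normSq ((star (hA.eigenvectorUnitary : Matrix (Fin n) (Fin n) ℂ) *ᵥ v) i) : ℝ) :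
          ℂ) := by
  rw [hA.cfc_eq, Matrix.IsHermitian.cfc, Unitary.conjStarAlgAut_apply]
  set U : Matrix (Fin n) (Fin n) ℂ := (hA.eigenvectorUnitary : Matrix (Fin n) (Fin n) ℂ) with hU
  set w := star U *ᵥ v with hw
  rw [← mulVec_mulVec, ← mulVec_mulVec, dotProduct_mulVec]
  have hsv : star v ᵥ* U = star w := by
    rw [hw, star_mulVec, star_eq_conjTranspose, conjTranspose_conjTranspose]
  rw [hsv, ← hw]
  simp only [dotProduct, mulVec_diagonal, Function.comp_apply, Pi.star_apply]
  push_cast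
  refine Finset.sum_congr rfl fun i _ => ?_
  have hc : (RCLike.ofReal (F (hA.eigenvalues i)) : ℂ) = ((F (hA.eigenvalues i) : ℝ) : ℂ) := rfl
  rw [hc, Complex.normSq_eq_conj_mul_self]
  simp only [RCLike.star_def]
  ring

/-- Löwner comparison of `cfc F A` and `cfc F B` through the spectral quadratic forms. [folklore] -/
theorem cfc_le_cfc_iff {A B : Matrix (Fin n) (Fin n) ℂ} (hA : A.IsHermitian) (hB : B.IsHermitian)
    (F : ℝ → ℝ) :
    cfc F A ≤ cfc F B ↔ ∀ v : Fin n → ℂ,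
      ∑ i, F (hA.eigenvalues i) *
          Complex.normSq ((star (hA.eigenvectorUnitary : Matrix (Fin n) (Fin n) ℂ) *ᵥ v) i) ≤
        ∑ i, F (hB.eigenvalues i) *
          Complex.normSq ((star (hB.eigenvectorUnitary : Matrix (Fin n) (Fin n) ℂ) *ᵥ v) i) := by
  have hherm : (cfc F B - cfc F A).IsHermitian := by
    have h1 : IsSelfAdjoint (cfc F B) := cfc_predicate F B
    have h2 : IsSelfAdjoint (cfc F A) := cfc_predicate F A
    exact h1.sub h2
  have hqf : ∀ v : Fin n → ℂ, star v ⬝ᵥ ((cfc F B - cfc F A) *ᵥ v) =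
      ((∑ i, F (hB.eigenvalues i) *
          Complex.normSq ((star (hB.eigenvectorUnitary : Matrix (Fin n) (Fin n) ℂ) *ᵥ v) i) -
        ∑ i, F (hA.eigenvalues i) *
          Complex.normSq ((star (hA.eigenvectorUnitary : Matrix (Fin n) (Fin n) ℂ) *ᵥ v) i) : ℝ) :
          ℂ) := by
    intro v
    rw [sub_mulVec, dotProduct_sub, star_dotProduct_cfc_mulVec hA, star_dotProduct_cfc_mulVec hB]
    push_cast; ring
  rw [Matrix.le_iff]
  constructor
  · intro h v
    have := h.dotProduct_mulVec_nonneg v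
    rw [hqf v, Complex.zero_le_real] at this
    linarith
  · intro h
    refine Matrix.PosSemidef.of_dotProduct_mulVec_nonneg hherm fun v => ?_
    rw [hqf v, Complex.zero_le_real]
    linarith [h v]

/-- Positive continuous superpositions `F(x) = κ + ∫₀^{2π} W(θ) (x-m)/(ρ - c(θ)(x-m)) dθ`
(`W ≥ 0`, `|c| ≤ 1`) of the Möbius atoms are matrix monotone on `(m - ρ, m + ρ)`. [folklore] -/
theorem cfc_le_cfc_of_repr {m ρ κ : ℝ} (hρ : 0 < ρ) {W c : ℝ → ℝ} (hW : Continuous W)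
    (hc : Continuous c) (hW0 : ∀ θ, 0 ≤ W θ) (hc1 : ∀ θ, |c θ| ≤ 1) {F : ℝ → ℝ}
    (hF : ∀ x ∈ Set.Ioo (m - ρ) (m + ρ),
      F x = κ + ∫ θ in (0 : ℝ)..2 * Real.pi, W θ * ((x - m) / (ρ - c θ * (x - m))))
    {A B : Matrix (Fin n) (Fin n) ℂ} (hA : A.IsHermitian) (hB : B.IsHermitian)
    (hAs : spectrum ℝ A ⊆ Set.Ioo (m - ρ) (m + ρ)) (hBs : spectrum ℝ B ⊆ Set.Ioo (m - ρ) (m + ρ))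
    (hAB : A ≤ B) : cfc F A ≤ cfc F B := by
  have hA' : IsSelfAdjoint A := hA
  have hB' : IsSelfAdjoint B := hB
  set I : ℝ → ℝ := fun x => ∫ θ in (0 : ℝ)..2 * Real.pi, W θ * ((x - m) / (ρ - c θ * (x - m)))
    with hI
  have hFA : (spectrum ℝ A).EqOn F (fun x => κ + I x) := fun x hx => hF x (hAs hx)
  have hFB : (spectrum ℝ B).EqOn F (fun x => κ + I x) := fun x hx => hF x (hBs hx)
  rw [cfc_congr hFA, cfc_congr hFB,
    cfc_const_add κ I A ((Matrix.finite_real_spectrum (A := A)).continuousOn _),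
    cfc_const_add κ I B ((Matrix.finite_real_spectrum (A := B)).continuousOn _)]
  gcongr
  rw [cfc_le_cfc_iff hA hB]
  intro v
  set qA : Fin n → ℝ := fun i =>
    Complex.normSq ((star (hA.eigenvectorUnitary : Matrix (Fin n) (Fin n) ℂ) *ᵥ v) i) with hqA
  set qB : Fin n → ℝ := fun i =>
    Complex.normSq ((star (hB.eigenvectorUnitary : Matrix (Fin n) (Fin n) ℂ) *ᵥ v) i) with hqB
  have hαA : ∀ i, hA.eigenvalues i ∈ Set.Ioo (m - ρ) (m + ρ) := fun i =>
    hAs (hA.eigenvalues_mem_spectrum_real i)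
  have hαB : ∀ i, hB.eigenvalues i ∈ Set.Ioo (m - ρ) (m + ρ) := fun i =>
    hBs (hB.eigenvalues_mem_spectrum_real i)
  -- the integrands, as functions of θ, for a point `a` of the interval
  have hcont : ∀ a ∈ Set.Ioo (m - ρ) (m + ρ), ∀ q : ℝ,
      Continuous fun θ => W θ * ((a - m) / (ρ - c θ * (a - m))) * q := by
    intro a ha q
    refine (hW.mul (continuous_const.div (continuous_const.sub (hc.mul continuous_const))
      fun θ => (atom_den_pos (hc1 θ) ha).ne')).mul continuous_const
  have hsum : ∀ {E : Matrix (Fin n) (Fin n) ℂ} (hE : E.IsHermitian)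
      (hEs : ∀ i, hE.eigenvalues i ∈ Set.Ioo (m - ρ) (m + ρ)) (q : Fin n → ℝ),
      ∑ i, I (hE.eigenvalues i) * q i =
        ∫ θ in (0 : ℝ)..2 * Real.pi,
          W θ * ∑ i, (hE.eigenvalues i - m) / (ρ - c θ * (hE.eigenvalues i - m)) * q i := by
    intro E hE hEs q
    simp only [hI, ← intervalIntegral.integral_mul_const]
    rw [← intervalIntegral.integral_finsetSum]
    · refine intervalIntegral.integral_congr fun θ _ => ?_
      simp only [Finset.mul_sum, mul_assoc]
    · intro i _
      exact (hcont _ (hEs i) (q i)).intervalIntegrable _ _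
  change ∑ i, I (hA.eigenvalues i) * qA i ≤ ∑ i, I (hB.eigenvalues i) * qB i
  rw [hsum hA hαA qA, hsum hB hαB qB]
  refine intervalIntegral.integral_mono_on (by positivity) ?_ ?_ fun θ _ => ?_
  · refine (hW.mul (continuous_finsetSum _ fun i _ => ?_)).intervalIntegrable _ _
    exact (continuous_const.div (continuous_const.sub (hc.mul continuous_const))
      fun θ => (atom_den_pos (hc1 θ) (hαA i)).ne').mul continuous_const
  · refine (hW.mul (continuous_finsetSum _ fun i _ => ?_)).intervalIntegrable _ _
    exact (continuous_const.div (continuous_const.sub (hc.mul continuous_const))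
      fun θ => (atom_den_pos (hc1 θ) (hαB i)).ne').mul continuous_const
  · refine mul_le_mul_of_nonneg_left ?_ (hW0 θ)
    exact (cfc_le_cfc_iff hA hB _).mp (atom_mono hρ (hc1 θ) hA hB hAs hBs hAB) v

/-- Matrix monotonicity passes to pointwise limits (finite spectra). [folklore] -/
theorem cfc_le_cfc_of_tendsto {A B : Matrix (Fin n) (Fin n) ℂ} (hA : A.IsHermitian)
    (hB : B.IsHermitian) {F : ℕ → ℝ → ℝ} {f : ℝ → ℝ}
    (hlim : ∀ x ∈ spectrum ℝ A ∪ spectrum ℝ B, Tendsto (fun k => F k x) atTop (𝓝 (f x)))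
    (hmono : ∀ k, cfc (F k) A ≤ cfc (F k) B) : cfc f A ≤ cfc f B := by
  rw [cfc_le_cfc_iff hA hB]
  intro v
  refine le_of_tendsto_of_tendsto' (b := atTop) ?_ ?_
    fun k => (cfc_le_cfc_iff hA hB (F k)).mp (hmono k) v
  · exact tendsto_finsetSum _ fun i _ =>
      (hlim _ (Or.inl (hA.eigenvalues_mem_spectrum_real i))).mul_const _
  · exact tendsto_finsetSum _ fun i _ =>
      (hlim _ (Or.inr (hB.eigenvalues_mem_spectrum_real i))).mul_const _

end MatrixSide


/-! ### The semicircle formula -/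

/-- The kernel of the semicircle formula: for `‖z‖ = 1` and real `|u| < 1`,
`Re ((z/(z-u) - 1 - uz/(1-uz)) g) = (2u Im z / |z-u|²) Im g`. [folklore] -/
theorem kernel_mul_re {u : ℝ} (hu : |u| < 1) {z : ℂ} (hz : ‖z‖ = 1) (g : ℂ) :
    ((z / (z - u) - 1 - u * z / (1 - u * z)) * g).re =
      2 * u / Complex.normSq (z - u) * z.im * g.im := by
  have hz1 : z * conj z = 1 := by
    rw [Complex.mul_conj, Complex.normSq_eq_norm_sq, hz]; norm_num
  have hzu : z - u ≠ 0 := by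
    intro h
    have : z = u := sub_eq_zero.mp h
    rw [this, Complex.norm_real, Real.norm_eq_abs] at hz
    linarith
  have hzu' : conj z - u ≠ 0 := by
    have : conj z - u = conj (z - u) := by rw [map_sub, Complex.conj_ofReal]
    rw [this]
    exact (map_ne_zero (starRingEnd ℂ)).mpr hzu
  have h1uz : (1 : ℂ) - u * z ≠ 0 := by
    intro h
    have h' : (u : ℂ) * z = 1 := (sub_eq_zero.mp h).symm
    have : ‖(u : ℂ) * z‖ = 1 := by rw [h']; simp
    rw [norm_mul, Complex.norm_real, Real.norm_eq_abs, hz, mul_one] at this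
    linarith
  have hA : z / (z - u) - 1 = u / (z - u) := by field_simp; ring
  have hB : (u : ℂ) * z / (1 - u * z) = u / (conj z - u) := by
    rw [div_eq_div_iff h1uz hzu']
    linear_combination (u : ℂ) * hz1
  have hK : z / (z - u) - 1 - u * z / (1 - u * z) = u / (z - u) - conj ((u : ℂ) / (z - u)) := by
    rw [map_div₀, map_sub, Complex.conj_ofReal, ← hB, hA]
  rw [hK, Complex.sub_conj]
  have him : ((u : ℂ) / (z - u)).im = -(u * z.im) / Complex.normSq (z - u) := by
    rw [Complex.div_im, Complex.ofReal_im, Complex.ofReal_re, Complex.sub_im, Complex.ofReal_im]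
    ring
  rw [him]
  simp only [Complex.mul_re, Complex.ofReal_re, Complex.ofReal_im, Complex.I_re, Complex.I_im,
    Complex.mul_im]
  ring

/-- **Semicircle (conjugate-Poisson) formula.** For `G` holomorphic on the closed unit disc and real
`|u| < 1`: `Re G(u) = Re G(0) + (2π)⁻¹ ∫₀^{2π} (2u Im ζ / |ζ - u|²) Im G(ζ) dθ`, `ζ = e^{iθ}`
(from Cauchy's formula `G(u) = ⨍ ζ/(ζ-u) G`, the mean value property `G(0) = ⨍ G`, and Cauchy's
theorem `⨍ (uζ/(1-uζ)) G = 0`). [folklore] -/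
theorem re_eq_re_zero_add_integral {G : ℂ → ℂ} (hG : DiffContOnCl ℂ G (ball 0 1)) {u : ℝ}
    (hu : |u| < 1) :
    (G u).re = (G 0).re + (2 * π)⁻¹ * ∫ θ in (0 : ℝ)..2 * π,
      2 * u / Complex.normSq (circleMap 0 1 θ - u) * (circleMap 0 1 θ).im *
        (G (circleMap 0 1 θ)).im := by
  have hG' : DiffContOnCl ℂ G (ball 0 |1|) := by rwa [abs_one]
  have hGc : ContinuousOn G (closedBall 0 1) := by
    simpa [closure_ball (0 : ℂ) one_ne_zero] using hG.continuousOn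
  have hu' : (u : ℂ) ∈ ball (0 : ℂ) |1| := by
    simpa [Complex.norm_real] using hu
  -- (1) Cauchy: ⨍ z/(z-u) G = G u
  have h1 : circleAverage (fun z => (z / (z - u)) * G z) 0 1 = G u := by
    simpa using hG'.circleAverage_smul_div hu'
  -- (2) mean value: ⨍ G = G 0
  have h2 : circleAverage G 0 1 = G 0 := hG'.circleAverage
  -- (3) Cauchy's theorem: ⨍ (uz/(1-uz)) G = 0
  have h1uz : ∀ z ∈ closedBall (0 : ℂ) 1, (1 : ℂ) - u * z ≠ 0 := by
    intro z hz h
    have h' : (u : ℂ) * z = 1 := (sub_eq_zero.mp h).symm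
    have : ‖(u : ℂ) * z‖ = 1 := by rw [h']; simp
    rw [norm_mul, Complex.norm_real, Real.norm_eq_abs] at this
    have hz' : ‖z‖ ≤ 1 := by simpa using hz
    nlinarith [abs_nonneg u, norm_nonneg z]
  have h3 : circleAverage (fun z => (u * z / (1 - u * z)) * G z) 0 1 = 0 := by
    have hk : DiffContOnCl ℂ (fun z : ℂ => u * z / (1 - u * z)) (ball 0 |1|) := by
      apply DifferentiableOn.diffContOnCl
      rw [abs_one, closure_ball (0 : ℂ) one_ne_zero]
      intro z hz
      apply DifferentiableAt.differentiableWithinAt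
      have := h1uz z hz
      fun_prop (disch := exact this)
    have := (hk.smul hG').circleAverage
    simpa using this
  -- integrability of the pieces
  have hsph : sphere (0 : ℂ) 1 ⊆ closedBall 0 1 := sphere_subset_closedBall
  have hzu : ∀ z ∈ sphere (0 : ℂ) 1, z - u ≠ 0 := by
    intro z hz h
    have : z = u := sub_eq_zero.mp h
    have hz1 : ‖z‖ = 1 := by simpa using hz
    rw [this, Complex.norm_real, Real.norm_eq_abs] at hz1
    linarith
  have hk1 : ContinuousOn (fun z : ℂ => z / (z - u)) (sphere 0 1) :=
    ContinuousOn.div continuousOn_id (continuousOn_id.sub continuousOn_const) hzu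
  have hk3 : ContinuousOn (fun z : ℂ => u * z / (1 - u * z)) (sphere 0 1) :=
    ContinuousOn.div (continuousOn_const.mul continuousOn_id)
      (continuousOn_const.sub (continuousOn_const.mul continuousOn_id)) fun z hz => h1uz z (hsph hz)
  have hi1 : CircleIntegrable (fun z => (z / (z - u)) * G z) 0 1 :=
    ContinuousOn.circleIntegrable zero_le_one (hk1.mul (hGc.mono hsph))
  have hi2 : CircleIntegrable G 0 1 := ContinuousOn.circleIntegrable zero_le_one (hGc.mono hsph)
  have hi3 : CircleIntegrable (fun z => (u * z / (1 - u * z)) * G z) 0 1 :=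
    ContinuousOn.circleIntegrable zero_le_one (hk3.mul (hGc.mono hsph))
  have hi12 : CircleIntegrable (fun z => (z / (z - u)) * G z - G z) 0 1 := hi1.sub hi2
  have hi4 : CircleIntegrable (fun z => (z / (z - u) - 1 - u * z / (1 - u * z)) * G z) 0 1 :=
    ContinuousOn.circleIntegrable zero_le_one
      (((hk1.sub continuousOn_const).sub hk3).mul (hGc.mono hsph))
  -- combine
  have h4 : G u - G 0 =
      circleAverage (fun z => (z / (z - u) - 1 - u * z / (1 - u * z)) * G z) 0 1 := by
    have e1 := circleAverage_fun_sub hi1 hi2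
    have e2 := circleAverage_fun_sub hi12 hi3
    rw [h1, h2] at e1
    rw [e1, h3, sub_zero] at e2
    rw [← e2]
    congr 1
    ext z
    ring
  -- take real parts
  have h5 : (G u).re - (G 0).re =
      circleAverage (fun z => ((z / (z - u) - 1 - u * z / (1 - u * z)) * G z).re) 0 1 := by
    rw [← Complex.sub_re, h4]
    have := ContinuousLinearMap.circleAverage_comp_comm Complex.reCLM hi4
    simp only [Function.comp_def, Complex.reCLM_apply] at this
    exact this.symm
  have h6 : circleAverage (fun z => ((z / (z - u) - 1 - u * z / (1 - u * z)) * G z).re) 0 1 =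
      circleAverage (fun z => 2 * u / Complex.normSq (z - u) * z.im * (G z).im) 0 1 := by
    apply circleAverage_congr_sphere
    intro z hz
    have hz1 : ‖z‖ = 1 := by simpa using hz
    exact kernel_mul_re hu hz1 (G z)
  rw [h6, Real.circleAverage_def, smul_eq_mul] at h5
  linarith

/-! ### The slit domain `Π ∪ Π̃ ∪ Δ` and Schwarz reflection -/

/-- The domain `Π ∪ Π̃ ∪ Δ` of Loewner's theorem is `{z | Im z ≠ 0 ∨ Re z ∈ Δ}`. [folklore] -/
theorem pickDomain_eq (Δ : Set ℝ) :
    UpperHalfPlane.upperHalfPlaneSet ∪ lowerHalfPlaneSet ∪ ((↑) '' Δ : Set ℂ) =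
      {z : ℂ | z.im ≠ 0 ∨ z.re ∈ Δ} := by
  ext z
  simp only [lowerHalfPlaneSet, mem_union, mem_setOf_eq, mem_image]
  constructor
  · rintro ((h | h) | ⟨x, hx, rfl⟩)
    · exact Or.inl h.ne'
    · exact Or.inl h.ne
    · exact Or.inr (by simpa using hx)
  · rintro (h | h)
    · rcases lt_or_gt_of_ne h with h' | h'
      · exact Or.inl (Or.inr h')
      · exact Or.inl (Or.inl h')
    · by_cases hi : z.im = 0
      · exact Or.inr ⟨z.re, h, Complex.ext (by simp) (by simp [hi])⟩
      · rcases lt_or_gt_of_ne hi with h' | h'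
        · exact Or.inl (Or.inr h')
        · exact Or.inl (Or.inl h')

/-- `{z | Im z ≠ 0 ∨ Re z ∈ Δ}` is open for open `Δ`. [folklore] -/
theorem isOpen_pickDomain {Δ : Set ℝ} (hΔ : IsOpen Δ) :
    IsOpen {z : ℂ | z.im ≠ 0 ∨ z.re ∈ Δ} :=
  IsOpen.union (isOpen_ne_fun Complex.continuous_im continuous_const)
    (hΔ.preimage Complex.continuous_re)

/-- `{z | Im z ≠ 0 ∨ Re z ∈ Δ}` is star-convex about any real point of the interval `Δ`.
[folklore] -/
theorem starConvex_pickDomain {Δ : Set ℝ} (hΔc : Δ.OrdConnected) {x₀ : ℝ} (hx₀ : x₀ ∈ Δ) :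
    StarConvex ℝ (x₀ : ℂ) {z : ℂ | z.im ≠ 0 ∨ z.re ∈ Δ} := by
  intro y hy a b ha hb hab
  simp only [mem_setOf_eq, Complex.add_im, Complex.smul_im, Complex.ofReal_im,
    Complex.add_re, Complex.smul_re, Complex.ofReal_re, smul_eq_mul, mul_zero, zero_add]
  rcases hy with hy | hy
  · by_cases hb0 : b = 0
    · subst hb0
      have ha1 : a = 1 := by linarith
      subst ha1
      right; simpa using hx₀
    · left; exact mul_ne_zero hb0 hy
  · right
    exact hΔc.convex hx₀ hy ha hb hab

/-- **Schwarz reflection by the identity theorem.** A function holomorphic on the slit domain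
`{Im z ≠ 0 ∨ Re z ∈ Δ}` (`Δ` an open interval) and real on `Δ` satisfies `g(z̄) = conj (g z)`.
[folklore] -/
theorem apply_conj_eq_conj_of_real_on {g : ℂ → ℂ} {Δ : Set ℝ} (hΔo : IsOpen Δ) (hΔc : Δ.OrdConnected)
    {x₀ : ℝ} (hx₀ : x₀ ∈ Δ) (hg : DifferentiableOn ℂ g {z : ℂ | z.im ≠ 0 ∨ z.re ∈ Δ})
    (hreal : ∀ x ∈ Δ, (g x).im = 0) {z : ℂ} (hz : z ∈ {z : ℂ | z.im ≠ 0 ∨ z.re ∈ Δ}) :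
    g (conj z) = conj (g z) := by
  set U : Set ℂ := {z : ℂ | z.im ≠ 0 ∨ z.re ∈ Δ} with hU
  have hUo : IsOpen U := isOpen_pickDomain hΔo
  have hUconj : ∀ w : ℂ, w ∈ U → conj w ∈ U := by
    intro w hw
    simpa [hU, Complex.conj_im, Complex.conj_re] using hw
  have hx₀U : (x₀ : ℂ) ∈ U := Or.inr (by simpa using hx₀)
  have hpre : IsPreconnected U :=
    ((starConvex_pickDomain hΔc hx₀).isPathConnected hx₀U).isConnected.isPreconnected
  set gs : ℂ → ℂ := fun w => conj (g (conj w)) with hgs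
  have hga : AnalyticOnNhd ℂ g U := hg.analyticOnNhd hUo
  have hgsd : DifferentiableOn ℂ gs U := by
    intro w hw
    have h1 : DifferentiableAt ℂ g (conj w) := hg.differentiableAt (hUo.mem_nhds (hUconj w hw))
    have h2 : DifferentiableAt ℂ (conj ∘ g ∘ conj) w := differentiableAt_conj_conj_iff.mpr h1
    exact h2.differentiableWithinAt
  have hgsa : AnalyticOnNhd ℂ gs U := hgsd.analyticOnNhd hUo
  -- `gs = g` frequently near `x₀` (indeed on `Δ`)
  have ht : Tendsto (fun t : ℝ => (t : ℂ)) (𝓝[≠] x₀) (𝓝[≠] (x₀ : ℂ)) := by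
    refine Complex.continuous_ofReal.continuousWithinAt.tendsto_nhdsWithin ?_
    intro t ht
    simpa using ht
  have hev : ∀ᶠ t : ℝ in 𝓝[≠] x₀, gs t = g t := by
    have : ∀ᶠ t : ℝ in 𝓝[≠] x₀, t ∈ Δ := eventually_nhdsWithin_of_eventually_nhds (hΔo.mem_nhds hx₀)
    filter_upwards [this] with t ht
    simp only [hgs, Complex.conj_ofReal]
    exact Complex.conj_eq_iff_im.mpr (hreal t ht)
  have hfreq : ∃ᶠ w in 𝓝[≠] (x₀ : ℂ), gs w = g w := ht.frequently hev.frequently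
  have heq : EqOn gs g U := hgsa.eqOn_of_preconnected_of_frequently_eq hga hpre hx₀U hfreq
  have := heq (hUconj z hz)
  simp only [hgs, Complex.conj_conj] at this
  exact this.symm

/-- A Pick function holomorphic on the slit domain and real on `Δ` has `Im g ≤ 0` on `Π̃`.
[folklore] -/
theorem im_nonpos_of_im_neg {g : ℂ → ℂ} {Δ : Set ℝ} (hΔo : IsOpen Δ) (hΔc : Δ.OrdConnected)
    {x₀ : ℝ} (hx₀ : x₀ ∈ Δ) (hg : DifferentiableOn ℂ g {z : ℂ | z.im ≠ 0 ∨ z.re ∈ Δ})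
    (hreal : ∀ x ∈ Δ, (g x).im = 0) (hpos : ∀ z : ℂ, 0 < z.im → 0 ≤ (g z).im) {z : ℂ}
    (hz : z.im < 0) : (g z).im ≤ 0 := by
  have hzU : conj z ∈ {z : ℂ | z.im ≠ 0 ∨ z.re ∈ Δ} := Or.inl (by simp [hz.ne])
  have h := apply_conj_eq_conj_of_real_on hΔo hΔc hx₀ hg hreal hzU
  rw [Complex.conj_conj] at h
  rw [h, Complex.conj_im]
  have : 0 ≤ (g (conj z)).im := hpos _ (by simpa using hz)
  linarith

/-! ### The conformal map `ζ ↦ 2ζ/(1+ζ²)` of the disc onto `ℂ ∖ (ℝ ∖ (-1,1))` -/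

/-- `1 + ζ² ≠ 0` on the open unit disc. [folklore] -/
theorem one_add_sq_ne_zero {ζ : ℂ} (h : ‖ζ‖ < 1) : 1 + ζ ^ 2 ≠ 0 := by
  intro h0
  have : ‖ζ ^ 2‖ = 1 := by
    have : ζ ^ 2 = -1 := by linear_combination h0
    rw [this]; simp
  rw [norm_pow] at this
  nlinarith [norm_nonneg ζ]

/-- `Im (2ζ/(1+ζ²)) = 2 Im ζ (1 - |ζ|²)/|1+ζ²|²`. [folklore] -/
theorem im_jouk (ζ : ℂ) :
    (2 * ζ / (1 + ζ ^ 2)).im = 2 * ζ.im * (1 - Complex.normSq ζ) / Complex.normSq (1 + ζ ^ 2) := by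
  rw [Complex.div_im]
  simp only [Complex.mul_im, Complex.mul_re, Complex.re_ofNat, Complex.im_ofNat, Complex.add_re,
    Complex.one_re, Complex.add_im, Complex.one_im, Complex.normSq_apply, sq]
  ring

/-- `J(ζ) = 2ζ/(1+ζ²)` maps the upper half-disc into `Π`. [folklore] -/
theorem im_jouk_pos {ζ : ℂ} (h : ‖ζ‖ < 1) (hi : 0 < ζ.im) : 0 < (2 * ζ / (1 + ζ ^ 2)).im := by
  rw [im_jouk]
  have h1 : Complex.normSq ζ < 1 := by
    rw [Complex.normSq_eq_norm_sq]; nlinarith [norm_nonneg ζ]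
  have h2 : 0 < Complex.normSq (1 + ζ ^ 2) := Complex.normSq_pos.mpr (one_add_sq_ne_zero h)
  apply div_pos _ h2
  nlinarith

/-- `J(ζ) = 2ζ/(1+ζ²)` maps the lower half-disc into `Π̃`. [folklore] -/
theorem im_jouk_neg {ζ : ℂ} (h : ‖ζ‖ < 1) (hi : ζ.im < 0) : (2 * ζ / (1 + ζ ^ 2)).im < 0 := by
  rw [im_jouk]
  have h1 : Complex.normSq ζ < 1 := by
    rw [Complex.normSq_eq_norm_sq]; nlinarith [norm_nonneg ζ]
  have h2 : 0 < Complex.normSq (1 + ζ ^ 2) := Complex.normSq_pos.mpr (one_add_sq_ne_zero h)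
  apply div_neg_of_neg_of_pos _ h2
  nlinarith

/-- `J` is real on the real axis. [folklore] -/
theorem jouk_ofReal (t : ℝ) :
    (2 * (t : ℂ) / (1 + (t : ℂ) ^ 2)) = ((2 * t / (1 + t ^ 2) : ℝ) : ℂ) := by
  push_cast; ring

/-- `J` maps `(-1,1)` into `(-1,1)`. [folklore] -/
theorem jouk_real_mem {t : ℝ} (ht : |t| < 1) : 2 * t / (1 + t ^ 2) ∈ Set.Ioo (-1 : ℝ) 1 := by
  have h1 : 0 < 1 + t ^ 2 := by positivity
  have h2 : (1 - |t|) ^ 2 > 0 := by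
    have : 1 - |t| ≠ 0 := by linarith
    positivity
  have habs : |t| ^ 2 = t ^ 2 := sq_abs t
  constructor
  · rw [lt_div_iff₀ h1]
    cases abs_cases t <;> nlinarith
  · rw [div_lt_iff₀ h1]
    cases abs_cases t <;> nlinarith

/-- Points `m + ρ·J(ζ)`, `‖ζ‖ < 1`, lie in the slit domain of `(m - ρ, m + ρ)`; sign of `Im`.
[folklore] -/
theorem jouk_mem_pickDomain {m ρ : ℝ} (hρ : 0 < ρ) {ζ : ℂ} (h : ‖ζ‖ < 1) :
    ((m : ℂ) + ρ * (2 * ζ / (1 + ζ ^ 2))) ∈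
      {z : ℂ | z.im ≠ 0 ∨ z.re ∈ Set.Ioo (m - ρ) (m + ρ)} := by
  rcases lt_trichotomy ζ.im 0 with hi | hi | hi
  · left
    have := im_jouk_neg h hi
    simp only [Complex.add_im, Complex.ofReal_im, Complex.mul_im, Complex.ofReal_re, zero_add,
      zero_mul, add_zero]
    exact (mul_neg_of_pos_of_neg hρ this).ne
  · right
    have hζ : ζ = (ζ.re : ℂ) := Complex.ext (by simp) (by simp [hi])
    have hre : |ζ.re| < 1 := lt_of_le_of_lt (Complex.abs_re_le_norm ζ) h
    rw [hζ, jouk_ofReal]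
    simp only [Complex.add_re, Complex.ofReal_re, Complex.mul_re, Complex.ofReal_im, zero_mul,
      sub_zero, mem_Ioo]
    have := jouk_real_mem hre
    constructor <;> nlinarith [this.1, this.2]
  · left
    have := im_jouk_pos h hi
    simp only [Complex.add_im, Complex.ofReal_im, Complex.mul_im, Complex.ofReal_re, zero_add,
      zero_mul, add_zero]
    exact (mul_pos hρ this).ne'

/-! ### The inverse point `u(X) = X/(1+√(1-X²))` -/

/-- `√(1-X²) > 0` and its square, for `|X| < 1`. [folklore] -/
theorem u_aux {X : ℝ} (hX : X ∈ Set.Ioo (-1 : ℝ) 1) :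
    0 < Real.sqrt (1 - X ^ 2) ∧ Real.sqrt (1 - X ^ 2) ^ 2 = 1 - X ^ 2 := by
  have h1 : 0 < 1 - X ^ 2 := by nlinarith [hX.1, hX.2]
  exact ⟨Real.sqrt_pos.mpr h1, Real.sq_sqrt h1.le⟩

/-- The inverse point `u(X) = X/(1+√(1-X²))` lies in `(-1,1)`. [folklore] -/
theorem abs_u_lt_one {X : ℝ} (hX : X ∈ Set.Ioo (-1 : ℝ) 1) :
    |X / (1 + Real.sqrt (1 - X ^ 2))| < 1 := by
  obtain ⟨hs, -⟩ := u_aux hX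
  have hpos : (0 : ℝ) < 1 + Real.sqrt (1 - X ^ 2) := by linarith
  rw [abs_div, abs_of_pos hpos, div_lt_one hpos]
  have : |X| < 1 := abs_lt.mpr ⟨hX.1, hX.2⟩
  linarith

/-- `1 + u(X)² = 2/(1+√(1-X²))`. [folklore] -/
theorem one_add_u_sq {X : ℝ} (hX : X ∈ Set.Ioo (-1 : ℝ) 1) :
    1 + (X / (1 + Real.sqrt (1 - X ^ 2))) ^ 2 = 2 / (1 + Real.sqrt (1 - X ^ 2)) := by
  obtain ⟨hs, hs2⟩ := u_aux hX
  have hne : 1 + Real.sqrt (1 - X ^ 2) ≠ 0 := by linarith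
  field_simp
  nlinarith [hs2]

/-- `2u(X) = X (1 + u(X)²)`, i.e. `J(u(X)) = X` cleared of denominators. [folklore] -/
theorem two_u_eq {X : ℝ} (hX : X ∈ Set.Ioo (-1 : ℝ) 1) :
    2 * (X / (1 + Real.sqrt (1 - X ^ 2))) = X * (1 + (X / (1 + Real.sqrt (1 - X ^ 2))) ^ 2) := by
  rw [one_add_u_sq hX]
  obtain ⟨hs, -⟩ := u_aux hX
  have hne : 1 + Real.sqrt (1 - X ^ 2) ≠ 0 := by linarith
  field_simp

/-- `J(u(X)) = X`: `u` inverts `J` on `(-1,1)`. [folklore] -/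
theorem jouk_u {X : ℝ} (hX : X ∈ Set.Ioo (-1 : ℝ) 1) :
    2 * (X / (1 + Real.sqrt (1 - X ^ 2))) / (1 + (X / (1 + Real.sqrt (1 - X ^ 2))) ^ 2) = X := by
  rw [two_u_eq hX, mul_div_assoc, div_self (by positivity), mul_one]

/-- On the unit circle the semicircle kernel at `u(X)` is the Möbius atom in `X`:
`2u/|z-u|² = X/(1 - Re z · X)`. [folklore] -/
theorem kernel_eq_atom {X : ℝ} (hX : X ∈ Set.Ioo (-1 : ℝ) 1) {z : ℂ} (hz : ‖z‖ = 1) :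
    2 * (X / (1 + Real.sqrt (1 - X ^ 2))) /
        Complex.normSq (z - (X / (1 + Real.sqrt (1 - X ^ 2)) : ℝ)) = X / (1 - z.re * X) := by
  set u := X / (1 + Real.sqrt (1 - X ^ 2)) with hu
  have hn : Complex.normSq (z - (u : ℂ)) = 1 - 2 * u * z.re + u ^ 2 := by
    have hz2 : z.re * z.re + z.im * z.im = 1 := by
      have := Complex.normSq_eq_norm_sq z
      rw [hz, Complex.normSq_apply] at this
      linarith
    rw [Complex.normSq_apply]
    simp only [Complex.sub_re, Complex.ofReal_re, Complex.sub_im, Complex.ofReal_im, sub_zero]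
    nlinarith [hz2]
  have hcX : 1 - z.re * X ≠ 0 := by
    have h1 : |z.re * X| < 1 := by
      rw [abs_mul]
      have := Complex.abs_re_le_norm z
      rw [hz] at this
      have hX' : |X| < 1 := abs_lt.mpr ⟨hX.1, hX.2⟩
      calc |z.re| * |X| ≤ 1 * |X| := by gcongr
        _ < 1 := by linarith
    linarith [(abs_lt.mp h1).2]
  have h1u : (1 : ℝ) + u ^ 2 ≠ 0 := by positivity
  have h2u : 2 * u = X * (1 + u ^ 2) := two_u_eq hX
  have hden : 1 - 2 * u * z.re + u ^ 2 = (1 + u ^ 2) * (1 - z.re * X) := by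
    linear_combination (-z.re) * h2u
  rw [hn, hden, h2u, mul_comm X (1 + u ^ 2), mul_div_mul_left X (1 - z.re * X) h1u]


/-! ### Assembly: Part II on a bounded interval, then on any open interval -/

section Assembly

variable {n : ℕ}

/-- **Engine of Part II.** For `g` holomorphic on the slit domain of `(m-ρ, m+ρ)` with
`Im g ≥ 0` on `Π` and `Im g ≤ 0` on `Π̃`, `x ↦ Re g(x)` is matrix monotone on `(m-ρ, m+ρ)`.
[cite: RosenblumRovnyak1985, Ch. 2 Examples and Addenda no. 2] -/
theorem cfc_re_le_cfc_re_of_pick {g : ℂ → ℂ} {m ρ : ℝ} (hρ : 0 < ρ)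
    (hg : DifferentiableOn ℂ g {z : ℂ | z.im ≠ 0 ∨ z.re ∈ Set.Ioo (m - ρ) (m + ρ)})
    (hpos : ∀ z : ℂ, 0 < z.im → 0 ≤ (g z).im) (hneg : ∀ z : ℂ, z.im < 0 → (g z).im ≤ 0)
    {A B : Matrix (Fin n) (Fin n) ℂ} (hA : A.IsHermitian) (hB : B.IsHermitian)
    (hAs : spectrum ℝ A ⊆ Set.Ioo (m - ρ) (m + ρ)) (hBs : spectrum ℝ B ⊆ Set.Ioo (m - ρ) (m + ρ))
    (hAB : A ≤ B) : cfc (fun x : ℝ => (g x).re) A ≤ cfc (fun x : ℝ => (g x).re) B := by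
  have hUo : IsOpen {z : ℂ | z.im ≠ 0 ∨ z.re ∈ Set.Ioo (m - ρ) (m + ρ)} :=
    isOpen_pickDomain isOpen_Ioo
  -- the approximants `F k x = Re g(m + ρ J(r_k u((x-m)/ρ)))`
  set G : ℝ → ℂ → ℂ := fun r z => g (m + ρ * (2 * (r * z) / (1 + (r * z) ^ 2))) with hG
  set uu : ℝ → ℝ := fun x => ((x - m) / ρ) / (1 + Real.sqrt (1 - ((x - m) / ρ) ^ 2)) with huu
  set r : ℕ → ℝ := fun k => 1 - 1 / ((k : ℝ) + 2) with hr
  set F : ℕ → ℝ → ℝ := fun k x => (G (r k) (uu x)).re with hF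
  have hr01 : ∀ k, 0 < r k ∧ r k < 1 := by
    intro k
    have hk : (2 : ℝ) ≤ (k : ℝ) + 2 := by have := (Nat.cast_nonneg k : (0 : ℝ) ≤ k); linarith
    constructor
    · simp only [hr]
      rw [sub_pos, div_lt_one (by linarith)]; linarith
    · simp only [hr]
      have : 0 < 1 / ((k : ℝ) + 2) := by positivity
      linarith
  have hrt : Tendsto r atTop (𝓝 1) := by
    have h1 : Tendsto (fun k : ℕ => 1 / ((k : ℝ) + 2)) atTop (𝓝 0) := by
      simp only [one_div]
      exact tendsto_inv_atTop_zero.comp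
        (tendsto_atTop_add_const_right _ _ tendsto_natCast_atTop_atTop)
    have := h1.const_sub 1
    simpa [hr] using this
  have hX : ∀ x ∈ Set.Ioo (m - ρ) (m + ρ), (x - m) / ρ ∈ Set.Ioo (-1 : ℝ) 1 := by
    intro x hx
    constructor
    · rw [lt_div_iff₀ hρ]; linarith [hx.1]
    · rw [div_lt_iff₀ hρ]; linarith [hx.2]
  -- `‖r z‖ < 1` on the closed disc
  have hrz : ∀ r : ℝ, 0 < r → r < 1 → ∀ z : ℂ, ‖z‖ ≤ 1 → ‖(r : ℂ) * z‖ < 1 := by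
    intro r hr0 hr1 z hz
    rw [norm_mul, Complex.norm_real, Real.norm_eq_abs, abs_of_pos hr0]
    nlinarith [norm_nonneg z]
  -- differentiability of `G r` on the closed unit disc
  have hGd : ∀ r : ℝ, 0 < r → r < 1 → ∀ z : ℂ, ‖z‖ ≤ 1 → DifferentiableAt ℂ (G r) z := by
    intro r hr0 hr1 z hz
    have h1 : 1 + ((r : ℂ) * z) ^ 2 ≠ 0 := one_add_sq_ne_zero (hrz r hr0 hr1 z hz)
    have hmem := jouk_mem_pickDomain (m := m) hρ (hrz r hr0 hr1 z hz)
    have hgat : DifferentiableAt ℂ g ((m : ℂ) + ρ * (2 * (r * z) / (1 + (r * z) ^ 2))) :=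
      hg.differentiableAt (hUo.mem_nhds hmem)
    have hinner : DifferentiableAt ℂ
        (fun z : ℂ => (m : ℂ) + ρ * (2 * (r * z) / (1 + (r * z) ^ 2))) z := by
      fun_prop (disch := exact h1)
    exact hgat.comp z hinner
  have hGdc : ∀ r : ℝ, 0 < r → r < 1 → DiffContOnCl ℂ (G r) (ball 0 1) := by
    intro r hr0 hr1
    apply DifferentiableOn.diffContOnCl
    rw [closure_ball (0 : ℂ) one_ne_zero]
    intro z hz
    exact (hGd r hr0 hr1 z (mem_closedBall_zero_iff.mp hz)).differentiableWithinAt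
  have hG0 : ∀ r : ℝ, G r 0 = g m := by intro r; simp [hG]
  -- nonnegativity of the weight `Im ζ · Im G_r(ζ)`
  have hW0 : ∀ r : ℝ, 0 < r → r < 1 → ∀ z : ℂ, ‖z‖ ≤ 1 → 0 ≤ z.im * (G r z).im := by
    intro r hr0 hr1 z hz
    have hrz' := hrz r hr0 hr1 z hz
    have him : ((r : ℂ) * z).im = r * z.im := by simp
    rcases lt_trichotomy z.im 0 with hi | hi | hi
    · have h1 : ((r : ℂ) * z).im < 0 := by rw [him]; exact mul_neg_of_pos_of_neg hr0 hi
      have h2 : ((m : ℂ) + ρ * (2 * (r * z) / (1 + (r * z) ^ 2))).im < 0 := by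
        have := im_jouk_neg hrz' h1
        simp only [Complex.add_im, Complex.ofReal_im, Complex.mul_im, Complex.ofReal_re, zero_add,
          zero_mul, add_zero]
        exact mul_neg_of_pos_of_neg hρ this
      exact mul_nonneg_of_nonpos_of_nonpos hi.le (hneg _ h2)
    · rw [hi, zero_mul]
    · have h1 : 0 < ((r : ℂ) * z).im := by rw [him]; exact mul_pos hr0 hi
      have h2 : 0 < ((m : ℂ) + ρ * (2 * (r * z) / (1 + (r * z) ^ 2))).im := by
        have := im_jouk_pos hrz' h1
        simp only [Complex.add_im, Complex.ofReal_im, Complex.mul_im, Complex.ofReal_re, zero_add,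
          zero_mul, add_zero]
        exact mul_pos hρ this
      exact mul_nonneg hi.le (hpos _ h2)
  -- Step 1: each `F k` is matrix monotone on the interval
  have hmono : ∀ k, cfc (F k) A ≤ cfc (F k) B := by
    intro k
    obtain ⟨hr0, hr1⟩ := hr01 k
    have hGc : Continuous fun θ : ℝ => G (r k) (circleMap 0 1 θ) := by
      have h1 : ContinuousOn (G (r k)) (closedBall 0 1) := fun z hz =>
        (hGd (r k) hr0 hr1 z (mem_closedBall_zero_iff.mp hz)).continuousAt.continuousWithinAt
      exact h1.comp_continuous (continuous_circleMap 0 1) fun θ => by simp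
    refine cfc_le_cfc_of_repr (κ := (g m).re) hρ
      (W := fun θ => (2 * π)⁻¹ * ((circleMap 0 1 θ).im * (G (r k) (circleMap 0 1 θ)).im))
      (c := fun θ => (circleMap 0 1 θ).re) ?_ ?_ ?_ ?_ ?_ hA hB hAs hBs hAB
    · exact continuous_const.mul
        ((Complex.continuous_im.comp (continuous_circleMap 0 1)).mul
          (Complex.continuous_im.comp hGc))
    · exact Complex.continuous_re.comp (continuous_circleMap 0 1)
    · intro θ
      exact mul_nonneg (by positivity) (hW0 (r k) hr0 hr1 _ (by simp))
    · intro θ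
      exact (Complex.abs_re_le_norm _).trans (by simp)
    · intro x hx
      have hXx := hX x hx
      have hu1 : |uu x| < 1 := abs_u_lt_one hXx
      have key := re_eq_re_zero_add_integral (hGdc (r k) hr0 hr1) hu1
      simp only [hF]
      rw [key, hG0, ← intervalIntegral.integral_const_mul]
      congr 1
      refine intervalIntegral.integral_congr fun θ _ => ?_
      have hz1 : ‖circleMap 0 1 θ‖ = 1 := by simp
      have hka := kernel_eq_atom hXx hz1
      simp only [huu]
      rw [hka]
      have hden := atom_den_pos (m := m) (ρ := ρ) (c := (circleMap 0 1 θ).re)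
        ((Complex.abs_re_le_norm _).trans (by simp)) hx
      have hka' : (x - m) / ρ / (1 - (circleMap 0 1 θ).re * ((x - m) / ρ)) =
          (x - m) / (ρ - (circleMap 0 1 θ).re * (x - m)) := by
        rw [div_div]
        congr 1
        field_simp
      rw [hka']
      ring
  -- Step 2: `F k → Re g` pointwise on the spectra
  have hlim : ∀ x ∈ spectrum ℝ A ∪ spectrum ℝ B,
      Tendsto (fun k => F k x) atTop (𝓝 ((g x).re)) := by
    intro x hx
    have hxI : x ∈ Set.Ioo (m - ρ) (m + ρ) := hx.elim (fun h => hAs h) (fun h => hBs h)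
    have hXx := hX x hxI
    have hxU : (x : ℂ) ∈ {z : ℂ | z.im ≠ 0 ∨ z.re ∈ Set.Ioo (m - ρ) (m + ρ)} :=
      Or.inr (by simpa using hxI)
    -- the path `t ↦ m + ρ J(t u)` through `x` at `t = 1`
    set P : ℝ → ℂ := fun t =>
      (m : ℂ) + ρ * (2 * ((t : ℂ) * (uu x : ℂ)) / (1 + ((t : ℂ) * (uu x : ℂ)) ^ 2)) with hP
    have hden : ∀ t : ℝ, (1 : ℂ) + ((t : ℂ) * (uu x : ℂ)) ^ 2 ≠ 0 := by
      intro t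
      have : (1 : ℂ) + ((t : ℂ) * (uu x : ℂ)) ^ 2 = ((1 + (t * uu x) ^ 2 : ℝ) : ℂ) := by
        push_cast; ring
      rw [this]
      exact_mod_cast (by positivity : (1 + (t * uu x) ^ 2 : ℝ) ≠ 0)
    have hPc : Continuous P := by
      simp only [hP]
      refine continuous_const.add (continuous_const.mul ?_)
      exact Continuous.div (by fun_prop) (by fun_prop) hden
    have hP1 : P 1 = x := by
      simp only [hP, Complex.ofReal_one, one_mul]
      have h1 := jouk_u hXx
      simp only [huu]
      rw [jouk_ofReal, h1]
      push_cast
      field_simp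
      ring
    have hgc : ContinuousAt g (x : ℂ) := (hg.differentiableAt (hUo.mem_nhds hxU)).continuousAt
    have h1 : Tendsto (fun k => g (P (r k))) atTop (𝓝 (g x)) := by
      have hPt : Tendsto P (𝓝 1) (𝓝 (x : ℂ)) := by
        rw [← hP1]; exact hPc.continuousAt.tendsto
      exact hgc.tendsto.comp (hPt.comp hrt)
    have h2 := (Complex.continuous_re.tendsto _).comp h1
    exact h2
  exact cfc_le_cfc_of_tendsto hA hB hlim hmono

/-- **Loewner's theorem, Part II (matrix form)** (Löwner 1934; Rosenblum–Rovnyak 1985, Ch. 2,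
Examples and Addenda no. 1, II, restricted to `dim ℋ < ∞`): if `f = g|Δ` where `g` is holomorphic
on `Π ∪ Π̃ ∪ Δ` (`Δ` an open interval) and `Im g ≥ 0` on `Π`, then `f` is a monotone matrix
function on `Δ`.
[cite: RosenblumRovnyak1985, Ch. 2 Examples and Addenda no. 1 (Loewner's theorem, Part II)] -/
theorem isMatrixMonotoneOn_of_pick_continuation {f : ℝ → ℝ} {Δ : Set ℝ} (hΔo : IsOpen Δ)
    (hΔc : Δ.OrdConnected) {g : ℂ → ℂ}
    (hg : DifferentiableOn ℂ g
      (UpperHalfPlane.upperHalfPlaneSet ∪ lowerHalfPlaneSet ∪ ((↑) '' Δ : Set ℂ)))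
    (hgim : ∀ z ∈ UpperHalfPlane.upperHalfPlaneSet, 0 ≤ (g z).im) (hgf : ∀ x ∈ Δ, g x = f x) :
    IsMatrixMonotoneOn f Δ := by
  intro n A B hA hB hAs hBs hAB
  rw [pickDomain_eq] at hg
  have hpos : ∀ z : ℂ, 0 < z.im → 0 ≤ (g z).im := fun z hz => hgim z hz
  have hreal : ∀ x ∈ Δ, (g x).im = 0 := fun x hx => by rw [hgf x hx, Complex.ofReal_im]
  -- trivial case `n = 0`
  rcases Nat.eq_zero_or_pos n with rfl | hn
  · have : cfc f B - cfc f A = 0 := Subsingleton.elim _ _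
    rw [this]; exact Matrix.PosSemidef.zero
  -- enclose the (finite, nonempty) spectra in a bounded interval `(m-ρ, m+ρ) ⊆ Δ`
  haveI : Nonempty (Fin n) := ⟨⟨0, hn⟩⟩
  set S : Set ℝ := spectrum ℝ A ∪ spectrum ℝ B with hS
  have hSf : S.Finite := (Matrix.finite_real_spectrum (A := A)).union
    (Matrix.finite_real_spectrum (A := B))
  have hSne : S.Nonempty := by
    refine ⟨hA.eigenvalues ⟨0, hn⟩, Or.inl (hA.eigenvalues_mem_spectrum_real _)⟩
  have hSΔ : S ⊆ Δ := union_subset hAs hBs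
  obtain ⟨a₀, ha₀S, ha₀⟩ := hSf.isCompact.exists_isLeast hSne
  obtain ⟨b₀, hb₀S, hb₀⟩ := hSf.isCompact.exists_isGreatest hSne
  have hab₀ : a₀ ≤ b₀ := ha₀ hb₀S
  obtain ⟨ε₁, hε₁, hε₁Δ⟩ := Metric.isOpen_iff.mp hΔo a₀ (hSΔ ha₀S)
  obtain ⟨ε₂, hε₂, hε₂Δ⟩ := Metric.isOpen_iff.mp hΔo b₀ (hSΔ hb₀S)
  set ε := min ε₁ ε₂ with hε
  have hε0 : 0 < ε := lt_min hε₁ hε₂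
  have ha' : a₀ - ε / 2 ∈ Δ := hε₁Δ (by
    rw [Metric.mem_ball, Real.dist_eq, show a₀ - ε / 2 - a₀ = -(ε / 2) by ring, abs_neg,
      abs_of_pos (by positivity)]
    linarith [min_le_left ε₁ ε₂])
  have hb' : b₀ + ε / 2 ∈ Δ := hε₂Δ (by
    rw [Metric.mem_ball, Real.dist_eq, show b₀ + ε / 2 - b₀ = ε / 2 by ring,
      abs_of_pos (by positivity)]
    linarith [min_le_right ε₁ ε₂])
  set m := (a₀ + b₀) / 2 with hm
  set ρ := (b₀ - a₀) / 2 + ε / 2 with hρ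
  have hρ0 : 0 < ρ := by positivity
  have hIΔ : Set.Ioo (m - ρ) (m + ρ) ⊆ Δ := by
    intro x hx
    refine hΔc.out ha' hb' ⟨?_, ?_⟩
    · have := hx.1; simp only [hm, hρ] at this; linarith
    · have := hx.2; simp only [hm, hρ] at this; linarith
  have hSI : S ⊆ Set.Ioo (m - ρ) (m + ρ) := by
    intro x hx
    have h1 : a₀ ≤ x := ha₀ hx
    have h2 : x ≤ b₀ := hb₀ hx
    constructor
    · simp only [hm, hρ]; linarith
    · simp only [hm, hρ]; linarith
  have hAs' : spectrum ℝ A ⊆ Set.Ioo (m - ρ) (m + ρ) := subset_union_left.trans hSI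
  have hBs' : spectrum ℝ B ⊆ Set.Ioo (m - ρ) (m + ρ) := subset_union_right.trans hSI
  -- the engine on `(m-ρ, m+ρ)`
  obtain ⟨x₀, hx₀⟩ : Δ.Nonempty := ⟨a₀, hSΔ ha₀S⟩
  have hneg : ∀ z : ℂ, z.im < 0 → (g z).im ≤ 0 := fun z hz =>
    im_nonpos_of_im_neg hΔo hΔc hx₀ hg hreal hpos hz
  have hg' : DifferentiableOn ℂ g {z : ℂ | z.im ≠ 0 ∨ z.re ∈ Set.Ioo (m - ρ) (m + ρ)} :=
    hg.mono fun z hz => hz.imp id fun h => hIΔ h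
  have key := cfc_re_le_cfc_re_of_pick hρ0 hg' hpos hneg hA hB hAs' hBs' hAB
  -- `f = Re g` on the spectra
  have hfA : (spectrum ℝ A).EqOn f (fun x => (g x).re) := fun x hx => by
    simp [hgf x (hAs hx)]
  have hfB : (spectrum ℝ B).EqOn f (fun x => (g x).re) := fun x hx => by
    simp [hgf x (hBs hx)]
  rw [← Matrix.le_iff, cfc_congr hfA, cfc_congr hfB]
  exact key

/-- The (←) direction of `loewner_theorem`, verbatim (the Borel and local-boundedness
hypotheses are not needed for it).
[cite: RosenblumRovnyak1985, Ch. 2 Examples and Addenda no. 1 (Loewner's theorem, Part II)] -/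
theorem loewner_theorem_mpr (f : ℝ → ℝ) (Δ : Set ℝ) (hΔo : IsOpen Δ) (hΔc : Δ.OrdConnected)
    (_hΔn : Δ.Nonempty) (_hfm : Measurable f)
    (_hfb : ∀ K ⊆ Δ, IsCompact K → ∃ C : ℝ, ∀ x ∈ K, |f x| ≤ C) :
    (∃ g : ℂ → ℂ,
        DifferentiableOn ℂ g
            (UpperHalfPlane.upperHalfPlaneSet ∪ lowerHalfPlaneSet ∪ ((↑) '' Δ : Set ℂ)) ∧
          (∀ z ∈ UpperHalfPlane.upperHalfPlaneSet, 0 ≤ (g z).im) ∧ ∀ x ∈ Δ, g x = f x) →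
      IsMatrixMonotoneOn f Δ := by
  rintro ⟨g, hg, hgim, hgf⟩
  exact isMatrixMonotoneOn_of_pick_continuation hΔo hΔc hg hgim hgf

end Assembly

end Literature.Analysis.Complex

/-! ## Part B: Nevanlinna's representation — the converse, and the discharge -/

open MeasureTheory Metric Set Filter Real
open _root_.Complex
open scoped Topology

namespace Literature.Analysis.Complex

/-! ### Nevanlinna's representation: the converse -/

/-- The Nevanlinna kernel decomposes as
`1/(t - z) - t/(1 + t²) = (1 + z²)/((t - z)(1 + t²)) + z/(1 + t²)` (`t` real, `t ≠ z`).
[folklore] -/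
theorem nevanlinna_kernel_eq {t : ℝ} {z : ℂ} (htz : (t : ℂ) ≠ z) :
    ((t : ℂ) - z)⁻¹ - (t : ℂ) / (1 + (t : ℂ) ^ 2) =
      (1 + z ^ 2) * (((t : ℂ) - z)⁻¹ * (1 + (t : ℂ) ^ 2)⁻¹) + z * (1 + (t : ℂ) ^ 2)⁻¹ := by
  have htz' : (t : ℂ) - z ≠ 0 := sub_ne_zero.2 htz
  have h1 : (1 + (t : ℂ) ^ 2) ≠ 0 := by
    norm_cast
    positivity
  field_simp
  ring

/-- A real number is not a point of the open upper half-plane. [folklore] -/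
theorem ofReal_ne_of_im_pos {z : ℂ} (hz : 0 < z.im) (t : ℝ) : (t : ℂ) ≠ z := by
  intro h
  have := congrArg Complex.im h
  simp at this
  linarith

/-- The bound `|1/(t - z) - t/(1 + t²)| ≤ (|1 + z²|/Im z + |z|)/(1 + t²)` on `Π`. [folklore] -/
theorem norm_nevanlinna_kernel_le {z : ℂ} (hz : 0 < z.im) (t : ℝ) :
    ‖((t : ℂ) - z)⁻¹ - (t : ℂ) / (1 + (t : ℂ) ^ 2)‖ ≤
      (‖1 + z ^ 2‖ / z.im + ‖z‖) * (1 + t ^ 2)⁻¹ := by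
  rw [nevanlinna_kernel_eq (ofReal_ne_of_im_pos hz t)]
  have h1t : (1 + (t : ℂ) ^ 2) = ((1 + t ^ 2 : ℝ) : ℂ) := by push_cast; ring
  have hpos : (0 : ℝ) < 1 + t ^ 2 := by positivity
  have hn1 : ‖(1 + (t : ℂ) ^ 2)⁻¹‖ = (1 + t ^ 2)⁻¹ := by
    rw [h1t, norm_inv, Complex.norm_real, Real.norm_eq_abs, abs_of_pos hpos]
  have hn2 : ‖((t : ℂ) - z)⁻¹‖ ≤ (z.im)⁻¹ := by
    rw [norm_inv]
    apply inv_anti₀ hz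
    have := Complex.abs_im_le_norm ((t : ℂ) - z)
    simp only [sub_im, ofReal_im, zero_sub, abs_neg, abs_of_pos hz] at this
    exact this
  calc ‖(1 + z ^ 2) * (((t : ℂ) - z)⁻¹ * (1 + (t : ℂ) ^ 2)⁻¹) + z * (1 + (t : ℂ) ^ 2)⁻¹‖
      ≤ ‖(1 + z ^ 2) * (((t : ℂ) - z)⁻¹ * (1 + (t : ℂ) ^ 2)⁻¹)‖ + ‖z * (1 + (t : ℂ) ^ 2)⁻¹‖ :=
        norm_add_le _ _
    _ = ‖1 + z ^ 2‖ * (‖((t : ℂ) - z)⁻¹‖ * (1 + t ^ 2)⁻¹) + ‖z‖ * (1 + t ^ 2)⁻¹ := by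
        rw [norm_mul, norm_mul, norm_mul, hn1]
    _ ≤ ‖1 + z ^ 2‖ * ((z.im)⁻¹ * (1 + t ^ 2)⁻¹) + ‖z‖ * (1 + t ^ 2)⁻¹ := by
        gcongr
    _ = (‖1 + z ^ 2‖ / z.im + ‖z‖) * (1 + t ^ 2)⁻¹ := by ring

/-- The imaginary part of the Nevanlinna kernel is the Poisson kernel:
`Im (1/(t - z) - t/(1 + t²)) = Im z/|t - z|² ≥ 0`. [folklore] -/
theorem im_nevanlinna_kernel_nonneg {z : ℂ} (hz : 0 < z.im) (t : ℝ) :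
    0 ≤ (((t : ℂ) - z)⁻¹ - (t : ℂ) / (1 + (t : ℂ) ^ 2)).im := by
  have h1t : (t : ℂ) / (1 + (t : ℂ) ^ 2) = ((t / (1 + t ^ 2) : ℝ) : ℂ) := by push_cast; ring
  rw [sub_im, h1t, ofReal_im, sub_zero, inv_im]
  simp only [sub_im, ofReal_im, zero_sub, neg_neg]
  exact div_nonneg hz.le (Complex.normSq_nonneg _)

/-- The Nevanlinna integral `z ↦ ∫ (1/(t - z) - t/(1 + t²)) dμ(t)` is holomorphic on the upper
half-plane when `∫ dμ/(1 + t²) < ∞` (dominated holomorphic parameter integral). [folklore] -/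
theorem differentiableOn_nevanlinna_integral {μ : Measure ℝ}
    (hμ : Integrable (fun t : ℝ => (1 + t ^ 2)⁻¹) μ) :
    DifferentiableOn ℂ
      (fun z : ℂ => ∫ t : ℝ, (((t : ℂ) - z)⁻¹ - (t : ℂ) / (1 + (t : ℂ) ^ 2)) ∂μ)
      UpperHalfPlane.upperHalfPlaneSet := by
  apply differentiableOn_integral_of_dominated
  · intro z hz
    have hz' : 0 < z.im := hz
    refine Continuous.aestronglyMeasurable ?_
    refine Continuous.sub (Continuous.inv₀ (by fun_prop) fun t => sub_ne_zero.2
      (ofReal_ne_of_im_pos hz' t)) ?_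
    refine Continuous.div (by fun_prop) (by fun_prop) fun t => ?_
    norm_cast
    positivity
  · refine Filter.Eventually.of_forall fun t => ?_
    refine DifferentiableOn.sub (DifferentiableOn.inv (by fun_prop) ?_) (differentiableOn_const _)
    intro z hz
    exact sub_ne_zero.2 (ofReal_ne_of_im_pos hz t)
  · intro z₀ hz₀
    have hz₀' : 0 < z₀.im := hz₀
    set R : ℝ := z₀.im / 2 with hR
    have hRpos : 0 < R := by positivity
    have hball : ∀ z ∈ ball z₀ R, R ≤ z.im ∧ ‖z‖ ≤ ‖z₀‖ + R := by
      intro z hz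
      rw [mem_ball, dist_eq_norm] at hz
      constructor
      · have h1 := Complex.abs_im_le_norm (z - z₀)
        rw [sub_im] at h1
        have h2 : |z.im - z₀.im| < R := lt_of_le_of_lt h1 hz
        rw [abs_lt] at h2
        linarith [h2.1]
      · calc ‖z‖ = ‖z₀ + (z - z₀)‖ := by ring_nf
          _ ≤ ‖z₀‖ + ‖z - z₀‖ := norm_add_le _ _
          _ ≤ ‖z₀‖ + R := by linarith
    refine ⟨R, hRpos, fun z hz => lt_of_lt_of_le hRpos (hball z hz).1, ?_⟩
    set C₀ : ℝ := (1 + (‖z₀‖ + R) ^ 2) / R + (‖z₀‖ + R) with hC₀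
    refine ⟨fun t => C₀ * (1 + t ^ 2)⁻¹, hμ.const_mul C₀, Filter.Eventually.of_forall fun t => ?_⟩
    intro z hz
    obtain ⟨hzim, hznorm⟩ := hball z hz
    have hzpos : 0 < z.im := lt_of_lt_of_le hRpos hzim
    refine (norm_nevanlinna_kernel_le hzpos t).trans ?_
    apply mul_le_mul_of_nonneg_right _ (by positivity)
    have h1 : ‖1 + z ^ 2‖ ≤ 1 + (‖z₀‖ + R) ^ 2 := by
      calc ‖1 + z ^ 2‖ ≤ ‖(1 : ℂ)‖ + ‖z ^ 2‖ := norm_add_le _ _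
        _ = 1 + ‖z‖ ^ 2 := by rw [norm_one, norm_pow]
        _ ≤ 1 + (‖z₀‖ + R) ^ 2 := by gcongr
    have h2 : ‖1 + z ^ 2‖ / z.im ≤ (1 + (‖z₀‖ + R) ^ 2) / R := by
      calc ‖1 + z ^ 2‖ / z.im ≤ ‖1 + z ^ 2‖ / R := by
            apply div_le_div_of_nonneg_left (norm_nonneg _) hRpos hzim
        _ ≤ (1 + (‖z₀‖ + R) ^ 2) / R := by gcongr
    rw [hC₀]
    linarith

/-- The Nevanlinna kernel is integrable against `μ` for `z ∈ Π`. [folklore] -/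
theorem integrable_nevanlinna_kernel {μ : Measure ℝ}
    (hμ : Integrable (fun t : ℝ => (1 + t ^ 2)⁻¹) μ) {z : ℂ} (hz : 0 < z.im) :
    Integrable (fun t : ℝ => ((t : ℂ) - z)⁻¹ - (t : ℂ) / (1 + (t : ℂ) ^ 2)) μ := by
  refine Integrable.mono' (hμ.const_mul (‖1 + z ^ 2‖ / z.im + ‖z‖)) ?_
    (Filter.Eventually.of_forall fun t => norm_nevanlinna_kernel_le hz t)
  refine Continuous.aestronglyMeasurable ?_
  refine Continuous.sub (Continuous.inv₀ (by fun_prop) fun t => sub_ne_zero.2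
    (ofReal_ne_of_im_pos hz t)) ?_
  refine Continuous.div (by fun_prop) (by fun_prop) fun t => ?_
  norm_cast
  positivity

/-- **Converse of Nevanlinna's theorem** (Rosenblum–Rovnyak 1985, App. §6, after Theorem B):
every `f` given on `Π` by `b + cz + π⁻¹ ∫ (1/(t - z) - t/(1 + t²)) dμ(t)` with `b` real, `c ≥ 0`,
`∫ dμ/(1 + t²) < ∞` is a Pick function. [cite: RosenblumRovnyak1985, Appendix Section 6 Theorem B] -/
theorem isPickFunction_of_nevanlinna_repr {f : ℂ → ℂ} {b c : ℝ} {μ : Measure ℝ} (hc : 0 ≤ c)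
    (hμ : Integrable (fun t : ℝ => (1 + t ^ 2)⁻¹) μ)
    (hf : ∀ z ∈ UpperHalfPlane.upperHalfPlaneSet,
      f z = (b : ℂ) + (c : ℂ) * z +
        (Real.pi : ℂ)⁻¹ * ∫ t : ℝ, (((t : ℂ) - z)⁻¹ - (t : ℂ) / (1 + (t : ℂ) ^ 2)) ∂μ) :
    IsPickFunction f := by
  constructor
  · have hF : DifferentiableOn ℂ (fun z : ℂ => (b : ℂ) + (c : ℂ) * z +
        (Real.pi : ℂ)⁻¹ * ∫ t : ℝ, (((t : ℂ) - z)⁻¹ - (t : ℂ) / (1 + (t : ℂ) ^ 2)) ∂μ)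
        UpperHalfPlane.upperHalfPlaneSet :=
      DifferentiableOn.add (by fun_prop)
        (DifferentiableOn.const_mul (differentiableOn_nevanlinna_integral hμ) _)
    exact hF.congr hf
  · intro z hz
    have hz' : 0 < z.im := hz
    rw [hf z hz]
    have hint := integrable_nevanlinna_kernel hμ hz'
    have him : (∫ t : ℝ, (((t : ℂ) - z)⁻¹ - (t : ℂ) / (1 + (t : ℂ) ^ 2)) ∂μ).im =
        ∫ t : ℝ, (((t : ℂ) - z)⁻¹ - (t : ℂ) / (1 + (t : ℂ) ^ 2)).im ∂μ := by
      have h := integral_im hint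
      simpa using h.symm
    have hI : 0 ≤ ∫ t : ℝ, (((t : ℂ) - z)⁻¹ - (t : ℂ) / (1 + (t : ℂ) ^ 2)).im ∂μ :=
      integral_nonneg fun t => im_nevanlinna_kernel_nonneg hz' t
    have hpi : ((Real.pi : ℂ)⁻¹) = ((Real.pi⁻¹ : ℝ) : ℂ) := by push_cast; rfl
    simp only [add_im, ofReal_im, zero_add, mul_im, ofReal_re, zero_mul, add_zero, hpi, him]
    positivity

/-! ### The discharge -/

/-- **Nevanlinna's representation of the Pick class** — discharge of the named fact
`Literature.Analysis.Complex.nevanlinna_representation` (Rosenblum–Rovnyak 1985, Appendix §6,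
Theorem B with its converse): `IsPickFunction.exists_nevanlinna_repr` (via the Herglotz–Riesz
theorem on the disc and a Cayley transform) and `isPickFunction_of_nevanlinna_repr` (dominated
holomorphic parameter integral; `Im` of the kernel is the Poisson kernel).
[cite: RosenblumRovnyak1985, Appendix Section 6 Theorem B] -/
theorem nevanlinna_representation_holds : nevanlinna_representation := by
  intro f
  constructor
  · exact IsPickFunction.exists_nevanlinna_repr
  · rintro ⟨b, c, μ, hc, hμ, hf⟩
    exact isPickFunction_of_nevanlinna_repr hc hμ hf

end Literature.Analysis.Complex
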